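import Mathlib
import Summits.ResolutionOfSingularities.ResolutionOfSingularities.Theses.PAlteration
import Summits.ResolutionOfSingularities.ResolutionOfSingularities.Theorems.PAlterationAssemblyReduction
import Summits.ResolutionOfSingularities.ResolutionOfSingularities.Theorems.PAlterationAssemblyFrobenius
import Summits.ResolutionOfSingularities.ResolutionOfSingularities.Theorems.PAlterationPicoverToRadicialBottomFrobenius
import Summits.ResolutionOfSingularities.ResolutionOfSingularities.Theorems.PAlterationPicoverToRadicialBottomReducedPullback
import Literature.AlgebraicGeometry.Resolution.SurfaceResolutionReduction
import Literature.AlgebraicGeometry.Resolution.AlterationsNormalizationReduction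
import Literature.FieldTheory.Separability.PIndependentDerivations
import Summits.ResolutionOfSingularities.ResolutionOfSingularities.Theorems.PAlterationPicoverToRadicialBottomFiniteBirationalLift
import Summits.ResolutionOfSingularities.ResolutionOfSingularities.Theorems.PAlterationPicoverToRadicialBottomFrobeniusFactor
import Summits.ResolutionOfSingularities.ResolutionOfSingularities.Theorems.PAlterationPicoverToRadicialBottomRelPBasis
import Summits.ResolutionOfSingularities.ResolutionOfSingularities.Theorems.PAlterationPicoverToRadicialBottomFinitizedFactor
import Summits.ResolutionOfSingularities.ResolutionOfSingularities.Theorems.PAlterationPicoverToRadicialBottomTwistedResolution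
import Summits.ResolutionOfSingularities.ResolutionOfSingularities.Theorems.PAlterationPicoverToRadicialBottomReducedPullbackTransfer
import Summits.ResolutionOfSingularities.ResolutionOfSingularities.Theorems.PAlterationPicoverToRadicialBottomCofiniteRegularTwist

/-!
# Crux `PicoverToRadicialBottom` (stmt-ResolutionOfSingularities-0556) — line `theta-finite-cofinite-roots`

Proof by the line lead (prover-line-stmt-ResolutionOfSingularities-0556-1) composing the seven landed
stubs of the line (`stub_finiteBirationalLift`, `stub_frobeniusFactor`, `stub_relPBasis`,
`stub_cofiniteRegularTwist`, `stub_finitizedFactor`, `stub_twistedResolution`,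
`stub_reducedPullbackTransfer`; the cofinite-regular-twist stub takes the relative `p`-basis lemma
as an explicit hypothesis).

Proof of `PICover_p → RadicialBottom_p` for EVERY ground field `k` (card
`Cruxes/PicoverToRadicialBottom/Ideas/theta-finite-cofinite-roots.md`):

0. normalise `X` (`Scheme.HasResolution.of_normalization`), replacing the cover `X'' → X` by the
   reduced pull-back `T₀ := (X'' ×_X X^ν)_red → X^ν` (finite, radicial, surjective, `T₀` integral)
   which is finite birational over `X''`, so `T₀` inherits the resolution of `X''`
   (`stub_finiteBirationalLift`, `stub_reducedPullbackTransfer`);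
1. for normal `X`: a Frobenius factor `h : X → X''`, `h ≫ g = F^{p^r}` (`stub_frobeniusFactor`);
2. a field `L ⊇ k` inside `k^{1/p^r}` of finite codegree (`ψ : L → k`, `ψ ∘ ι = Frob^r`,
   `ι ∘ ψ = Frob^r`, `ψ` finite) with `Z ⊗_k L` REGULAR for the resolution `Z → X''`
   (`stub_cofiniteRegularTwist`, from the relative `p`-basis `stub_relPBasis`);
3. the finitized factor `h_L : X → (X'' ⊗_k L)_red`, finite + universally injective + surjective
   (`stub_finitizedFactor`);
4. `Z_L := Z ⊗_k L` is integral and resolves `(X'' ⊗_k L)_red` (`stub_twistedResolution`);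
5. `T := (X ×_{(X''⊗L)_red} Z_L)_red → Z_L` is a finite radicial surjective cover of a regular
   integral separated finite-type `L`-scheme: ONE call of `PICover_p` at the field `L` resolves `T`;
   `T → X` is proper birational (`stub_reducedPullbackTransfer`), so `X` has a resolution
   (`Scheme.HasResolution.of_isBirational`).
-/

noncomputable section

-- single-problem summit: the doubled namespace component `ResolutionOfSingularities` is forced
set_option linter.dupNamespace false

open CategoryTheory CategoryTheory.Limits AlgebraicGeometry TopologicalSpace Opposite
open Literature.AlgebraicGeometry.Resolution Literature.AlgebraicGeometry.Motives
open Literature.FieldTheory.Separability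
open Scheme.IdealSheafData

namespace Summit.ResolutionOfSingularities.ResolutionOfSingularities.Theorems

/-! ## Composition -/

section Composition

variable {p : ℕ} [Fact p.Prime]

/-- **The normal case.** `RadicialBottom_p` for a normal base `X`, from `PICover_p` and the
stubs: Frobenius factor, cofinite regular twist of the resolution, finitized factor, one
`PICover_p` call over `L`, reduced pull-back transfer. [folklore] -/
theorem hasResolution_of_normal_of_picoverAt
    (hPIC : ∀ (k : Type) [Field k] [CharP k p] (Y X : Scheme.{0}) (f : Y ⟶ Spec (.of k))
      (g : X ⟶ Y), IsSeparated f → LocallyOfFiniteType f → QuasiCompact f → IsIntegral Y →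
      Scheme.IsRegular Y → IsIntegral X → IsFinite g → UniversallyInjective g →
      Function.Surjective g.base → Scheme.HasResolution X)
    (k : Type) [Field k]
    [CharP k p] (X X'' : Scheme.{0}) (f : X ⟶ Spec (.of k)) (g : X'' ⟶ X) [IsSeparated f]
    [LocallyOfFiniteType f] [QuasiCompact f] [IsIntegral X] [IsIntegral X''] [IsFinite g]
    [UniversallyInjective g] [Surjective g]
    (hN : ∀ x : X, IsIntegrallyClosed (X.presheaf.stalk x))
    (hres : Scheme.HasResolution X'') : Scheme.HasResolution X := by
  -- characteristic `p` on sections, compactness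
  have hXp : (p : Γ(X, ⊤)) = 0 := natCast_appTop_eq_zero p f
  haveI : CompactSpace X := by
    have := QuasiCompact.isCompact_preimage (f := f) (U := ⊤) isOpen_univ
      (by simp)
    exact ⟨by simpa using this⟩
  -- S1: Frobenius factor
  obtain ⟨r, h, hh⟩ := stub_frobeniusFactor p X X'' g hN hXp
  -- the resolution of `X''`
  obtain ⟨Z, π, hπ⟩ := hres
  haveI : IsProper π := hπ.isProper
  -- S2: cofinite regular twist of `Z`
  obtain ⟨L, _, _, ψ, hψ1, hψ2, hψfin, hZL⟩ :=
    stub_cofiniteRegularTwist stub_relPBasis p k Z (π ≫ g ≫ f) hπ.isRegular r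
  set ι : Spec (.of L) ⟶ Spec (.of k) := Spec.map (CommRingCat.ofHom (algebraMap k L)) with hι
  -- S3: finitized factor
  obtain ⟨hL, hLfin, hLui, hLsurj⟩ :=
    stub_finitizedFactor p k L r ψ hψ1 hψ2 hψfin X X'' f g hXp h hh
  -- S4: `Z_L` is integral and resolves `(X'' ⊗ L)_red`
  have hexp : ∀ x : L, x ^ p ^ r ∈ (algebraMap k L).range := fun x => ⟨ψ x, hψ1 x⟩
  obtain ⟨hZLint, ρ, hρ, hρbir⟩ :=
    stub_twistedResolution p k L r hexp X'' Z (g ≫ f) π hπ.isBirational hZL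
  haveI := hZLint
  haveI := hρ
  haveI := hLfin
  haveI := hLui
  haveI := hLsurj
  -- the reduced pull-back `T := (X ×_{(X''⊗L)_red} Z_L)_red`
  let ZL := pullback (π ≫ g ≫ f) ι
  let T := (vanishingIdeal (⊤ : Closeds ↑(pullback hL ρ))).subscheme
  let gT : T ⟶ ZL := (vanishingIdeal (⊤ : Closeds ↑(pullback hL ρ))).subschemeι ≫ pullback.snd hL ρ
  haveI : IsIntegral T := isIntegral_reduced_pullback hL ρ
  haveI : IsFinite gT := isFinite_reduced_pullback_snd hL ρ
  haveI : UniversallyInjective gT := universallyInjective_reduced_pullback_snd hL ρ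
  haveI : Surjective gT := surjective_reduced_pullback_snd hL ρ
  -- `Z_L` is a regular integral separated finite-type `L`-scheme
  let fZL : ZL ⟶ Spec (.of L) := pullback.snd (π ≫ g ≫ f) ι
  haveI : CharP L p := charP_of_injective_algebraMap (algebraMap k L).injective p
  have hT : Scheme.HasResolution T :=
    hPIC L ZL T fZL gT inferInstance inferInstance inferInstance hZLint hZL inferInstance
      inferInstance inferInstance gT.surjective
  -- transfer along the proper birational `T → X`
  let ρT : T ⟶ X := (vanishingIdeal (⊤ : Closeds ↑(pullback hL ρ))).subschemeι ≫ pullback.fst hL ρ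
  have hρT : IsBirational ρT := stub_reducedPullbackTransfer X _ ZL hL ρ hρbir
  haveI : IsProper ρT := inferInstance
  exact Scheme.HasResolution.of_isBirational ρT hρT hT

/-- **`PicoverToRadicialBottom`** (stmt-ResolutionOfSingularities-0556), from the stubs: normalise
`X`, pull the cover back to the normalization (reduced), lift the resolution of `X''` to the
pulled-back cover (finite birational over `X''`), and apply the normal case. [folklore] -/
theorem picoverToRadicialBottom_proof_lead1 :
    Summit.ResolutionOfSingularities.ResolutionOfSingularities.Theses.PAlteration.PicoverToRadicialBottom := by
  intro p hp hPIC k _ _ X X'' f g hsep hlft hqc hX hX'' hfin hui hsurj hres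
  haveI : Fact p.Prime := ⟨hp⟩
  haveI := hsep; haveI := hlft; haveI := hqc; haveI := hX; haveI := hX''; haveI := hfin
  haveI := hui
  haveI : Surjective g := ⟨hsurj⟩
  -- normalise `X`
  haveI : IsFinite (normalizationι X) :=
    isFinite_normalizationι X NoetherFiniteIntegralClosure_holds f
  refine Scheme.HasResolution.of_normalization X f ?_
  let ν := normalizationι X
  -- the reduced pull-back cover `T₀ := (X'' ×_X X^ν)_red → X^ν`
  let T₀ := (vanishingIdeal (⊤ : Closeds ↑(pullback g ν))).subscheme
  let g₀ : T₀ ⟶ normalization X :=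
    (vanishingIdeal (⊤ : Closeds ↑(pullback g ν))).subschemeι ≫ pullback.snd g ν
  let φ : T₀ ⟶ X'' := (vanishingIdeal (⊤ : Closeds ↑(pullback g ν))).subschemeι ≫ pullback.fst g ν
  haveI : IsIntegral T₀ := isIntegral_reduced_pullback g ν
  haveI : IsFinite g₀ := isFinite_reduced_pullback_snd g ν
  haveI : UniversallyInjective g₀ := universallyInjective_reduced_pullback_snd g ν
  haveI : Surjective g₀ := surjective_reduced_pullback_snd g ν
  haveI : IsFinite φ := inferInstance
  -- `T₀` inherits the resolution of `X''` (finite birational over it)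
  have hφ : IsBirational φ :=
    stub_reducedPullbackTransfer X'' X (normalization X) g ν (isBirational_normalizationι X f)
  have hT₀ : Scheme.HasResolution T₀ :=
    stub_finiteBirationalLift k X'' T₀ (g ≫ f) φ hφ hres
  -- the normal case for `X^ν`
  exact hasResolution_of_normal_of_picoverAt (hPIC) k (normalization X) T₀ (ν ≫ f) g₀
    (isIntegrallyClosed_stalk_normalization X) hT₀

end Composition

end Summit.ResolutionOfSingularities.ResolutionOfSingularities.Theorems

end
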